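import Mathlib
import Summits.MatrixMultiplication.MatrixMultiplication.Theses.FourierTwoFamiliesModP
import Summits.MatrixMultiplication.MatrixMultiplication.Theorems.FourierTwoFamiliesModPCyclicReductionTransfer
import Summits.MatrixMultiplication.MatrixMultiplication.Theorems.FourierTwoFamiliesModPPrimeTwoFamiliesCapacityLift
import Summits.MatrixMultiplication.MatrixMultiplication.Theorems.FourierTwoFamiliesModPPrimeTwoFamiliesStubGadgetsOfCrux

/-!
# Self-converse gadgets in `ℤ/m` ↔ `PrimeTwoFamilies` — the direct `L = 2` transfer
# (crux stmt-MatrixMultiplication-14308, line `Sketch`, stub `selfConverseGadgets_iff_primeTwoFamilies`)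

The crux `FourierTwoFamiliesModP.PrimeTwoFamilies` is CKSU 2005 Conj. 4.7 ("two families") with prime cyclic
hosts: for every `δ > 0` and arbitrarily large `n`, a prime `p ≤ n^{2+δ}` and `n` pairs `(A i, B i)` in `ℤ/p`
with the simultaneous double product property — (W) every pair is direct, (X) `(a - a') + (b - b') = 0` with
`a ∈ A i, a' ∈ A j, b ∈ B j, b' ∈ B k` forces `i = k` — and `|A i| |B i| ≥ n^{2-δ}`.

A SELF-CONVERSE GADGET at level `m` is a list of direct pairs ("letters") `(P c, Q c)_{c<r}` in `ℤ/m`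
together with a map `π : Fin r → Fin r` such that every ordered pair of distinct letters `σ ≠ τ` is
STRONGLY SEPARATED — every cross difference `q - p` (`p ∈ P σ`, `q ∈ Q τ`) avoids every diagonal
difference `q' - p'` (`p' ∈ P c`, `q' ∈ Q c`) — either directly or after applying `π`; it has slice `ε`
if `r ≥ m^{1-ε}` and every co-volume `|P c| |Q c| ≥ m^{1-ε}`.

Content (everything `sorry`-free):

* `exists_prime_sdpp_of_gadget` — the SINGLE-LEVEL TRANSFER with explicit constants: a self-converse
  gadget at any level `m ≥ 1` yields, for some prime `p ≤ 18 m²`, `r` SDPP pairs in `ℤ/p` whose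
  co-volumes are exactly `|P σ| |P (π σ)| · |Q σ| |Q (π σ)|` (graph-word blocks `selfConverseLift` in
  `ℤ/m × ℤ/m`, then the carry-free transfer `exists_prime_sdpp_of_addEquiv` along
  `ℤ/m × ℤ/m ≃+ (Fin 2 → ℤ/m)`).  This is the form a finite search for gadgets plugs into.
* `exponents_of_level` — the real-exponent bookkeeping of the `L = 2` transfer, with the explicit
  choices `ε = d/8`, level threshold `18 ≤ m^{d/2}`, and `m^{1-ε} ≤ n ≤ 2 m^{1-ε}` kept pairs.
* `primeTwoFamilies_of_selfConverseGadgets` — gadgets of every slice at arbitrarily large levels give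
  the crux (keep `n = ⌈m^{1-ε}⌉ ≤ r` of the transferred pairs).
* `selfConverseGadgets_iff_primeTwoFamilies` — the registered stub of line `Sketch`: the equivalence,
  whose converse is letter repetition (`CapacityLift.stub_gadgetsOfCrux`, reused, not re-proved).

Design note.  The tree already holds this equivalence as
`CapacityLift.selfConverseGadgets_iff_primeTwoFamilies` (file `…CapacityEquivalences`), proved through the
general code lift (`stub_selfConverse : self-converse ⇒ capacity gadgets of all word lengths L`) and the
uniform-in-`L` bookkeeping `stub_capBookkeeping`.  The present file is the direct `L = 2` route: its
forward direction depends only on Mathlib, the route transfer lemma and `selfConverseLift`, and it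
exposes the non-asymptotic single-level statement with its constant `18`.
-/

-- single-conjunct summit: the mandated namespace repeats `MatrixMultiplication` (summit = sub-problem).
set_option linter.dupNamespace false

namespace Summit.MatrixMultiplication.MatrixMultiplication.Theorems.PrimeTwoFamilies.SelfConverseMathlibRoute

open Finset
open Summit.MatrixMultiplication.MatrixMultiplication.Theses
open Summit.MatrixMultiplication.MatrixMultiplication.Theorems.PrimeTwoFamilies.CapacityLift

/-! ## §1 The single-level transfer -/

/-- **Single-level transfer of a self-converse gadget.**  Let `(P c, Q c)_{c<r}` be direct pairs in
`ZMod m` (`1 ≤ m`) and `π : Fin r → Fin r` a map such that every ordered pair of distinct letters is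
strongly separated directly or after `π`.  Then there are a prime `p ≤ 18 m²` and `r` pairs
`(A σ, B σ)` in `ZMod p` satisfying (W) and (X) verbatim, with
`|A σ| = |P σ| |P (π σ)|` and `|B σ| = |Q σ| |Q (π σ)|`.  Proof: the graph-word blocks
`(P σ ×ˢ P (π σ), Q σ ×ˢ Q (π σ))` are an SDPP family in `ℤ/m × ℤ/m` (`selfConverseLift`); move them by
the carry-free transfer `exists_prime_sdpp_of_addEquiv` along `ℤ/m × ℤ/m ≃+ (Fin 2 → ℤ/m)`, whose host
bound is `2 · 3² · m² = 18 m²`. -/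
theorem exists_prime_sdpp_of_gadget {m r : ℕ} (hm : 1 ≤ m) (P Q : Fin r → Finset (ZMod m))
    (π : Fin r → Fin r)
    (hD : ∀ c : Fin r, ∀ x ∈ P c, ∀ x' ∈ P c, ∀ y ∈ Q c, ∀ y' ∈ Q c,
      (x - x') + (y - y') = 0 → x = x' ∧ y = y')
    (hπ : ∀ σ τ : Fin r, σ ≠ τ →
      (∀ p ∈ P σ, ∀ q ∈ Q τ, ∀ c : Fin r, ∀ p' ∈ P c, ∀ q' ∈ Q c, q - p ≠ q' - p') ∨
      (∀ p ∈ P (π σ), ∀ q ∈ Q (π τ), ∀ c : Fin r, ∀ p' ∈ P c, ∀ q' ∈ Q c, q - p ≠ q' - p')) :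
    ∃ p : ℕ, p.Prime ∧ p ≤ 18 * m ^ 2 ∧ ∃ A B : Fin r → Finset (ZMod p),
      (∀ σ : Fin r, (A σ).card = (P σ).card * (P (π σ)).card ∧
        (B σ).card = (Q σ).card * (Q (π σ)).card) ∧
      (∀ i : Fin r, ∀ a ∈ A i, ∀ a' ∈ A i, ∀ b ∈ B i, ∀ b' ∈ B i,
          (a - a') + (b - b') = 0 → a = a' ∧ b = b') ∧
      (∀ i j k : Fin r, ∀ a ∈ A i, ∀ a' ∈ A j, ∀ b ∈ B j, ∀ b' ∈ B k,
          (a - a') + (b - b') = 0 → i = k) := by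
  classical
  obtain ⟨hW2, hX2⟩ := selfConverseLift P Q hD π hπ
  obtain ⟨p, hp, hpR, A', B', hcard, hW', hX'⟩ :=
    exists_prime_sdpp_of_addEquiv (A := fun σ => P σ ×ˢ P (π σ)) (B := fun σ => Q σ ×ˢ Q (π σ))
      hW2 hX2 (m := fun _ : Fin 2 => m) (fun _ => hm)
      (LinearEquiv.finTwoArrow ℤ (ZMod m)).symm.toAddEquiv
  rw [Fin.prod_const] at hpR
  refine ⟨p, hp, by omega, A', B', fun σ => ?_, hW', hX'⟩
  rw [(hcard σ).1, (hcard σ).2, card_product, card_product]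
  exact ⟨rfl, rfl⟩

/-! ## §2 Exponent bookkeeping -/

/-- **Exponents at a gadget level.**  For `0 < d ≤ 1`, a level `m ≥ 1` with `18 ≤ m^{d/2}`, and a
number of kept pairs `n` with `m^{1-d/8} ≤ n ≤ 2 m^{1-d/8}`: the transferred host size `18 m²` is at
most `n^{2+d}`, and `n^{2-d} ≤ m^{1-d/8} · m^{1-d/8}` (the guaranteed co-volume of a graph-word block at
slice `ε = d/8`).  Elementary: `(1 - d/8)(2 + d) ≥ 2 + d/2` and `d/2 + (1 - d/8)(2 - d) ≤ 2 (1 - d/8)` on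
`(0, 1]`, `2^{2-d} ≤ 4 ≤ 18`. -/
theorem exponents_of_level {d m n : ℝ} (hd : 0 < d) (hd1 : d ≤ 1) (hm1 : 1 ≤ m)
    (h18 : 18 ≤ m ^ (d / 2)) (hxn : m ^ (1 - d / 8) ≤ n) (hnx : n ≤ 2 * m ^ (1 - d / 8)) :
    18 * m ^ (2 : ℝ) ≤ n ^ (2 + d) ∧ n ^ (2 - d) ≤ m ^ (1 - d / 8) * m ^ (1 - d / 8) := by
  have hm0 : 0 < m := by linarith
  have hx0 : 0 ≤ m ^ (1 - d / 8) := by positivity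
  refine ⟨?_, ?_⟩
  · -- `18 m² ≤ m^{d/2} m² = m^{2+d/2} ≤ m^{(1-d/8)(2+d)} = (m^{1-d/8})^{2+d} ≤ n^{2+d}`
    have hexp : 2 + d / 2 ≤ (1 - d / 8) * (2 + d) := by nlinarith
    calc 18 * m ^ (2 : ℝ) ≤ m ^ (d / 2) * m ^ (2 : ℝ) :=
          mul_le_mul_of_nonneg_right h18 (by positivity)
      _ = m ^ (2 + d / 2) := by rw [mul_comm, ← Real.rpow_add hm0]
      _ ≤ m ^ ((1 - d / 8) * (2 + d)) := Real.rpow_le_rpow_of_exponent_le hm1 hexp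
      _ = (m ^ (1 - d / 8)) ^ (2 + d) := Real.rpow_mul hm0.le _ _
      _ ≤ n ^ (2 + d) := Real.rpow_le_rpow hx0 hxn (by linarith)
  · -- `n^{2-d} ≤ (2 m^{1-d/8})^{2-d} ≤ 4 m^{(1-d/8)(2-d)} ≤ m^{d/2} m^{(1-d/8)(2-d)} ≤ m^{2(1-d/8)}`
    have h2 : (2 : ℝ) ^ (2 - d) ≤ 4 := by
      calc (2 : ℝ) ^ (2 - d) ≤ (2 : ℝ) ^ (2 : ℝ) :=
            Real.rpow_le_rpow_of_exponent_le (by norm_num) (by linarith)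
        _ = 4 := by norm_num
    have hexp : d / 2 + (1 - d / 8) * (2 - d) ≤ (1 - d / 8) + (1 - d / 8) := by nlinarith
    calc n ^ (2 - d) ≤ (2 * m ^ (1 - d / 8)) ^ (2 - d) :=
          Real.rpow_le_rpow (hx0.trans hxn) hnx (by linarith)
      _ = (2 : ℝ) ^ (2 - d) * m ^ ((1 - d / 8) * (2 - d)) := by
          rw [Real.mul_rpow (by norm_num) hx0, ← Real.rpow_mul hm0.le]
      _ ≤ 18 * m ^ ((1 - d / 8) * (2 - d)) := by
          have : 0 ≤ m ^ ((1 - d / 8) * (2 - d)) := by positivity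
          nlinarith
      _ ≤ m ^ (d / 2) * m ^ ((1 - d / 8) * (2 - d)) :=
          mul_le_mul_of_nonneg_right h18 (by positivity)
      _ = m ^ (d / 2 + (1 - d / 8) * (2 - d)) := (Real.rpow_add hm0 _ _).symm
      _ ≤ m ^ ((1 - d / 8) + (1 - d / 8)) := Real.rpow_le_rpow_of_exponent_le hm1 hexp
      _ = m ^ (1 - d / 8) * m ^ (1 - d / 8) := Real.rpow_add hm0 _ _

/-! ## §3 Gadgets give the crux -/

/-- **Self-converse gadgets give `PrimeTwoFamilies`.**  Given `δ > 0` and `n₀`, put `d = min δ 1`,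
`ε = d/8`, and take a gadget level `m ≥ max (n₀²) ⌈18^{2/d}⌉ + 1` of slice `ε`.  The single-level
transfer `exists_prime_sdpp_of_gadget` gives `r` SDPP pairs in `ℤ/p`, `p` prime, `p ≤ 18 m²`, of
co-volume `≥ m^{1-ε} m^{1-ε}`; keep the first `n = ⌈m^{1-ε}⌉ ≤ r` of them.  Then
`n₀ ≤ √m ≤ m^{1-ε} ≤ n`, and `exponents_of_level` gives `p ≤ 18 m² ≤ n^{2+d} ≤ n^{2+δ}` and
`n^{2-δ} ≤ n^{2-d} ≤ m^{1-ε} m^{1-ε} ≤ |A i| |B i|`. -/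
theorem primeTwoFamilies_of_selfConverseGadgets
    (hG : ∀ ε : ℝ, 0 < ε → ∀ m₀ : ℕ, ∃ m ≥ m₀, ∃ r : ℕ, ∃ P Q : Fin r → Finset (ZMod m),
      ∃ π : Fin r → Fin r,
      (∀ c : Fin r, ∀ x ∈ P c, ∀ x' ∈ P c, ∀ y ∈ Q c, ∀ y' ∈ Q c,
          (x - x') + (y - y') = 0 → x = x' ∧ y = y') ∧
      (∀ σ τ : Fin r, σ ≠ τ →
        (∀ p ∈ P σ, ∀ q ∈ Q τ, ∀ c : Fin r, ∀ p' ∈ P c, ∀ q' ∈ Q c, q - p ≠ q' - p') ∨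
        (∀ p ∈ P (π σ), ∀ q ∈ Q (π τ), ∀ c : Fin r, ∀ p' ∈ P c, ∀ q' ∈ Q c, q - p ≠ q' - p')) ∧
      (m : ℝ) ^ (1 - ε) ≤ (r : ℝ) ∧
      ∀ c : Fin r, (m : ℝ) ^ (1 - ε) ≤ (((P c).card * (Q c).card : ℕ) : ℝ)) :
    FourierTwoFamiliesModP.PrimeTwoFamilies := by
  classical
  intro δ hδ n₀
  -- the slice parameter actually used, `d = min δ 1 ∈ (0, 1]`, and `ε = d / 8`
  set d : ℝ := min δ 1 with hd_def
  have hd : 0 < d := lt_min hδ one_pos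
  have hd1 : d ≤ 1 := min_le_right _ _
  have hdδ : d ≤ δ := min_le_left _ _
  have hε : (0 : ℝ) < d / 8 := by positivity
  -- a gadget level beyond `n₀ ^ 2` and `18 ^ (2 / d)`
  set M : ℕ := ⌈(18 : ℝ) ^ (2 / d)⌉₊ with hM_def
  obtain ⟨m, hm, r, P, Q, π, hD, hS, hr, hcov⟩ := hG (d / 8) hε (max (n₀ ^ 2) M + 1)
  have hmn₀ : n₀ ^ 2 ≤ m := le_trans (le_trans (le_max_left _ M) (Nat.le_succ _)) hm
  have hmM : M ≤ m := le_trans (le_trans (le_max_right (n₀ ^ 2) M) (Nat.le_succ _)) hm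
  have hm1 : 1 ≤ m := le_trans (Nat.succ_le_succ (Nat.zero_le _)) hm
  have hm1' : (1 : ℝ) ≤ m := by exact_mod_cast hm1
  have h18 : (18 : ℝ) ≤ (m : ℝ) ^ (d / 2) := by
    have h1 : (18 : ℝ) ^ (2 / d) ≤ m := (Nat.le_ceil _).trans (by exact_mod_cast hmM)
    have h2 : ((18 : ℝ) ^ (2 / d)) ^ (d / 2) ≤ (m : ℝ) ^ (d / 2) :=
      Real.rpow_le_rpow (by positivity) h1 (by positivity)
    rwa [← Real.rpow_mul (by norm_num), show (2 / d) * (d / 2) = 1 by field_simp, Real.rpow_one]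
      at h2
  -- transfer the whole gadget level into a prime cyclic group
  obtain ⟨p, hp, hp18, A', B', hcard, hW', hX'⟩ := exists_prime_sdpp_of_gadget hm1 P Q π hD hS
  have hp18' : (p : ℝ) ≤ 18 * (m : ℝ) ^ (2 : ℝ) := by
    rw [Real.rpow_two]
    exact_mod_cast hp18
  -- the number of pairs kept: `n = ⌈m^{1-ε}⌉ ≤ r`
  set x : ℝ := (m : ℝ) ^ (1 - d / 8) with hx_def
  have hx0 : 0 ≤ x := by positivity
  have hx1 : 1 ≤ x := Real.one_le_rpow hm1' (by linarith)
  set n : ℕ := ⌈x⌉₊ with hn_def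
  have hxn : x ≤ n := Nat.le_ceil x
  have hnx : (n : ℝ) ≤ 2 * x := by have := (Nat.ceil_lt_add_one hx0).le; linarith
  have hnr : n ≤ r := Nat.ceil_le.2 hr
  have hn1 : (1 : ℝ) ≤ n := hx1.trans hxn
  have hn₀ : n₀ ≤ n := by
    have h1 : (n₀ : ℝ) ≤ (m : ℝ) ^ (1 / 2 : ℝ) := by
      have h2 : (n₀ : ℝ) ^ 2 ≤ (m : ℝ) := by exact_mod_cast hmn₀
      calc (n₀ : ℝ) = ((n₀ : ℝ) ^ 2) ^ (1 / 2 : ℝ) := by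
            rw [← Real.sqrt_eq_rpow, Real.sqrt_sq (Nat.cast_nonneg _)]
        _ ≤ (m : ℝ) ^ (1 / 2 : ℝ) := Real.rpow_le_rpow (by positivity) h2 (by norm_num)
    have h3 : (m : ℝ) ^ (1 / 2 : ℝ) ≤ x := Real.rpow_le_rpow_of_exponent_le hm1' (by linarith)
    exact_mod_cast (h1.trans h3).trans hxn
  obtain ⟨hhost, hvol⟩ := exponents_of_level hd hd1 hm1' h18 hxn hnx
  refine ⟨n, hn₀, p, hp, A' ∘ Fin.castLE hnr, B' ∘ Fin.castLE hnr, ?_, ?_, ?_, ?_⟩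
  · intro i
    exact hW' (Fin.castLE hnr i)
  · intro i j k a ha a' ha' b hb b' hb' h0
    exact Fin.castLE_injective hnr (hX' _ _ _ a ha a' ha' b hb b' hb' h0)
  · -- `p ≤ 18 m² ≤ n^{2+d} ≤ n^{2+δ}`
    exact (hp18'.trans hhost).trans (Real.rpow_le_rpow_of_exponent_le hn1 (by linarith))
  · -- `n^{2-δ} ≤ n^{2-d} ≤ m^{1-ε} m^{1-ε} ≤ (|P σ| |Q σ|) (|P (π σ)| |Q (π σ)|) = |A i| |B i|`
    intro i
    have hci := hcard (Fin.castLE hnr i)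
    simp only [Function.comp_apply]
    rw [hci.1, hci.2, mul_mul_mul_comm (P _).card (P _).card (Q _).card (Q _).card, Nat.cast_mul]
    calc (n : ℝ) ^ (2 - δ) ≤ (n : ℝ) ^ (2 - d) := Real.rpow_le_rpow_of_exponent_le hn1 (by linarith)
      _ ≤ x * x := hvol
      _ ≤ _ := mul_le_mul (hcov _) (hcov _) hx0 (Nat.cast_nonneg _)

/-! ## §4 The equivalence (registered stub `selfConverseGadgets_iff_primeTwoFamilies`) -/

/-- **Self-converse gadgets ↔ `PrimeTwoFamilies`.**  For every `ε > 0` there are, at arbitrarily large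
levels `m`, `r ≥ m^{1-ε}` direct pairs `(P c, Q c)` in `ℤ/m` of co-volume `|P c| |Q c| ≥ m^{1-ε}` and a
map `π` on the letters such that every ordered pair of distinct letters is strongly separated directly or
after `π` — if and only if CKSU Conj. 4.7 holds with prime cyclic hosts.  (⇒) the direct `L = 2`
transfer `primeTwoFamilies_of_selfConverseGadgets`; (⇐) letter repetition,
`CapacityLift.stub_gadgetsOfCrux`.  In particular the `L = 2` form of the capacity line `Sketch` is
crux-equivalent, not stronger. -/
theorem selfConverseGadgets_iff_primeTwoFamilies :
    (∀ ε : ℝ, 0 < ε → ∀ m₀ : ℕ, ∃ m ≥ m₀, ∃ r : ℕ, ∃ P Q : Fin r → Finset (ZMod m),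
      ∃ π : Fin r → Fin r,
      (∀ c : Fin r, ∀ x ∈ P c, ∀ x' ∈ P c, ∀ y ∈ Q c, ∀ y' ∈ Q c,
          (x - x') + (y - y') = 0 → x = x' ∧ y = y') ∧
      (∀ σ τ : Fin r, σ ≠ τ →
        (∀ p ∈ P σ, ∀ q ∈ Q τ, ∀ c : Fin r, ∀ p' ∈ P c, ∀ q' ∈ Q c, q - p ≠ q' - p') ∨
        (∀ p ∈ P (π σ), ∀ q ∈ Q (π τ), ∀ c : Fin r, ∀ p' ∈ P c, ∀ q' ∈ Q c, q - p ≠ q' - p')) ∧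
      (m : ℝ) ^ (1 - ε) ≤ (r : ℝ) ∧
      ∀ c : Fin r, (m : ℝ) ^ (1 - ε) ≤ (((P c).card * (Q c).card : ℕ) : ℝ)) ↔
    FourierTwoFamiliesModP.PrimeTwoFamilies :=
  ⟨primeTwoFamilies_of_selfConverseGadgets, stub_gadgetsOfCrux⟩

end Summit.MatrixMultiplication.MatrixMultiplication.Theorems.PrimeTwoFamilies.SelfConverseMathlibRoute
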